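import Mathlib
import Literature.Barriers.ValiantsHypothesis.AlgebraicNaturalProofs
import Literature.Computability.AlgebraicComplexity.ArithCircuitProofs
import Literature.Computability.AlgebraicComplexity.HomogeneousComponentsComplexity
import Summits.ValiantsHypothesis.ValiantsHypothesis.Theorems.BarrierLeverPartitionMinorsHitByVPAdditiveDoor
import Summits.ValiantsHypothesis.ValiantsHypothesis.Theorems.BarrierLeverPartitionMinorsChowSwap
import Summits.ValiantsHypothesis.ValiantsHypothesis.Theses.BarrierLever

/-!
# Route BarrierLever — item `PartitionMinorsHitByVP` (stmt-ValiantsHypothesis-19717):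
# the SUM door — additive witness PLUS its mirror (candidate door of record v6)

Link file (`--supports stmt-ValiantsHypothesis-19717`; cell valiant-natproofs, rung V4, 𝒟-side,
prover seat val-np-p6 gen 4). Definition-free. Closes NO item: it reduces item 19717 BY NAME to the
generic nonsingularity of ONE two-table matrix family on every injective layout.

Door of record v5 (`…AdditiveDichotomy`: additive table OR its mirror) is refuted
(`…AdditiveDoubleObstruction.not_additiveDichotomy`, p524872): from `h = 5` on there are layouts
`(u, w)` on which the additive matrix `A[i,j] = ∏_{c ∈ w j} (ω₀ c + Σ_{a ∈ u i} ω a c)` is singular for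
every table AND the mirror matrix `B[i,j] = ∏_{a ∈ u i} (ω₀' a + Σ_{c ∈ w j} ω' c a)` is singular for
every table (doubly Hilbert-obstructed layouts, at every scale). The two obstructions are, however,
never SIMULTANEOUSLY bilinear: a table-free left null space of `A` has dimension `r − H_u(d)` when
all columns have weight `≤ d`, a table-free right null space of `B` has dimension `r − H_w(e)` when all
rows have weight `≤ e`, and `H_u(d) + H_w(e) < r` is impossible (`H_u(d) ≥ #{i : |u i| ≤ d}`, so
`d ≥ e` forces `H_u(d) = r`, and symmetrically). Hence the natural repair: ADD the two witnesses.
The polynomial `F(ω₀, ω) + swap(F(ω₀', ω'))` (swap = the `x ↔ y` renaming of `Fin (h+h)`) has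
coefficient matrix `A + B` on every layout (`coeff_additiveWitness_swap`), size `≤ 2(3h²+6h+1)+1`,
and its truncation to degree `≤ 2h` lies in `SmallCircuits ℂ (h+h) 5` for `h ≥ 3`.

* `coeff_additiveWitness_swap` — `coeff_{x^S y^T} swap(F(ω₀', ω')) = ∏_{a ∈ S} (ω₀' a + Σ_{c ∈ T} ω' c a)`
  (the swap and `mapDomain_flip_partitionExpo` are val-np-p4's `…ChowSwap`, reused).
* **`partitionMinor_hit_of_additiveSum`** — if SOME pair of tables gives `det (A + B) ≠ 0`, the layout
  is hit: explicit degree `≤ 2h` and size `≤ (2h+2)²(6h²+12h+3) + 2h + 1`;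
  **`partitionMinor_hit_of_additiveSum_mem`** — the same inside `SmallCircuits ℂ (h+h) 5` for `h ≥ 3`.
* **`partitionMinorsHitByVP_of_additiveSum`** — THE SUM DOOR: if for every `h ≥ 3` and every injective
  layout some pair of tables makes `det (A + B) ≠ 0`, then `Theses.BarrierLever.PartitionMinorsHitByVP`
  holds (`b = 5`, `h₀ = 3`).

EVIDENCE for the hypothesis (kit j276484 part C, `--workitem 19717`, exact arithmetic mod 2⁶¹−1, two
independent random tables): `det (A + B) ≠ 0` on the `h = 5`, `r = 10` counterexample to v5, on the
doubly obstructed family instances `(h, e, r) = (6,2,11), (7,2,16), (7,3,26), (8,3,42), (9,3,64),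
(9,4,99)` (all with `det A = det B = 0`), and on 33 800 random layouts (`h = 4, 5, 6`, `r ≤ 32`):
0 failures. CAPACITY AUDIT (planner rule, BARRIER-capacity.md): the row vectors of `A` restricted to
the columns `⊆ T` are arbitrary product vectors `⊗_{c∈T} (1, ℓ_c)`, which span all of `ℂ^{2^T}` — the
template has full capacity. The hypothesis is a universal two-table statement of the same logical
shape as `ChowHitsPartitionMinors` (item 20172); it is NOT claimed here.

WHAT THIS IS NOT: no proof of the hypothesis; nothing on crux 14610 or VP vs VNP.
-/

set_option linter.dupNamespace false

namespace Summit.ValiantsHypothesis.ValiantsHypothesis.Theorems.BarrierLever.AdditiveDoor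

open Finset MvPolynomial
open Literature.Barriers.ValiantsHypothesis Literature.Computability.AlgebraicComplexity

noncomputable section

variable {h : ℕ}

/-! ## 1. The swapped witness and its coefficients -/

/-- **Coefficients of the swapped additive witness.** With `swap` the `x ↔ y` renaming,
`coeff_{x^S y^T} swap(F(ω₀', ω')) = ∏_{a ∈ S} (ω₀' a + Σ_{c ∈ T} ω' c a)` — the MIRROR additive matrix. -/
theorem coeff_additiveWitness_swap (ω₀' : Fin h → ℂ) (ω' : Fin h → Fin h → ℂ) (S T : Finset (Fin h)) :
    MvPolynomial.coeff
      (∑ a ∈ S, Finsupp.single (Fin.castAdd h a) 1 + ∑ c ∈ T, Finsupp.single (Fin.natAdd h c) 1)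
      (rename (finSumFinEquiv.symm.trans ((Equiv.sumComm (Fin h) (Fin h)).trans finSumFinEquiv))
        ((∏ c : Fin h, (1 + C (ω₀' c) * X (Fin.natAdd h c))) *
          ∏ a : Fin h, (1 + X (Fin.castAdd h a) *
            ∏ c : Fin h, (1 + C (ω' a c) * X (Fin.natAdd h c))) : MvPolynomial (Fin (h + h)) ℂ)) =
      ∏ a ∈ S, (ω₀' a + ∑ c ∈ T, ω' c a) := by
  set τ := finSumFinEquiv.symm.trans ((Equiv.sumComm (Fin h) (Fin h)).trans finSumFinEquiv) with hτ
  have hexp : (∑ a ∈ S, Finsupp.single (Fin.castAdd h a) 1 +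
      ∑ c ∈ T, Finsupp.single (Fin.natAdd h c) 1 : Fin (h + h) →₀ ℕ) =
      Finsupp.mapDomain τ (∑ a ∈ T, Finsupp.single (Fin.castAdd h a) 1 +
        ∑ c ∈ S, Finsupp.single (Fin.natAdd h c) 1) := by
    rw [hτ, ChowFactor.mapDomain_flip_partitionExpo]
  rw [hexp, coeff_rename_mapDomain _ τ.injective, coeff_additiveWitness]

/-! ## 2. The sum witness: size and the door -/

/-- **THE SUM DOOR (explicit size).** If some pair of tables `(ω₀, ω)`, `(ω₀', ω')` makes
`det [∏_{c ∈ w j} (ω₀ c + Σ_{a ∈ u i} ω a c) + ∏_{a ∈ u i} (ω₀' a + Σ_{c ∈ w j} ω' c a)]_{i,j} ≠ 0`,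
the layout `(u, w)` has a nonsingular partition matrix at some `f` with `deg f ≤ 2h` and
`L(f) ≤ (2h+2)²(6h²+12h+3) + 2h + 1`. -/
theorem partitionMinor_hit_of_additiveSum {ι : Type*} [Fintype ι] [DecidableEq ι] (h : ℕ)
    (u w : ι → Finset (Fin h)) (ω₀ : Fin h → ℂ) (ω : Fin h → Fin h → ℂ)
    (ω₀' : Fin h → ℂ) (ω' : Fin h → Fin h → ℂ)
    (hdet : (Matrix.of fun i j : ι => ∏ c ∈ w j, (ω₀ c + ∑ a ∈ u i, ω a c) +
      ∏ a ∈ u i, (ω₀' a + ∑ c ∈ w j, ω' c a)).det ≠ 0) :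
    ∃ f : MvPolynomial (Fin (h + h)) ℂ, f.totalDegree ≤ h + h ∧
      complexity f ≤ (h + h + 2) ^ 2 * (6 * h * h + 12 * h + 3) + (h + h + 1) ∧
      (Matrix.of fun i j : ι => MvPolynomial.coeff
        (∑ a ∈ u i, Finsupp.single (Fin.castAdd h a) 1 +
          ∑ c ∈ w j, Finsupp.single (Fin.natAdd h c) 1) f).det ≠ 0 := by
  set τ := finSumFinEquiv.symm.trans ((Equiv.sumComm (Fin h) (Fin h)).trans finSumFinEquiv) with hτ
  set F : MvPolynomial (Fin (h + h)) ℂ := (∏ c : Fin h, (1 + C (ω₀ c) * X (Fin.natAdd h c))) *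
    ∏ a : Fin h, (1 + X (Fin.castAdd h a) * ∏ c : Fin h, (1 + C (ω a c) * X (Fin.natAdd h c)))
    with hF
  set F' : MvPolynomial (Fin (h + h)) ℂ := (∏ c : Fin h, (1 + C (ω₀' c) * X (Fin.natAdd h c))) *
    ∏ a : Fin h, (1 + X (Fin.castAdd h a) * ∏ c : Fin h, (1 + C (ω' a c) * X (Fin.natAdd h c)))
    with hF'
  set G : MvPolynomial (Fin (h + h)) ℂ := F + rename τ F' with hG
  have hsizeG : complexity G ≤ 6 * h * h + 12 * h + 3 := by
    calc complexity G ≤ complexity F + complexity (rename τ F') + 1 := complexity_add_le_holds _ _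
      _ ≤ (3 * h * h + 6 * h + 1) + (3 * h * h + 6 * h + 1) + 1 := by
          gcongr
          · exact complexity_additiveWitness_le ω₀ ω
          · exact (complexity_rename_le_holds' _ _).trans (complexity_additiveWitness_le ω₀' ω')
      _ = 6 * h * h + 12 * h + 3 := by ring
  obtain ⟨hdeg, hcoeff, hsize⟩ := truncation_spec G (h + h)
  refine ⟨∑ e ∈ Finset.range (h + h + 1), homogeneousComponent e G, hdeg, ?_, ?_⟩
  · exact hsize.trans (by gcongr)
  · have hmat : (Matrix.of fun i j : ι => MvPolynomial.coeff
        (∑ a ∈ u i, Finsupp.single (Fin.castAdd h a) 1 +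
          ∑ c ∈ w j, Finsupp.single (Fin.natAdd h c) 1)
        (∑ e ∈ Finset.range (h + h + 1), homogeneousComponent e G)) =
        Matrix.of fun i j : ι => ∏ c ∈ w j, (ω₀ c + ∑ a ∈ u i, ω a c) +
          ∏ a ∈ u i, (ω₀' a + ∑ c ∈ w j, ω' c a) := by
      ext i j
      rw [Matrix.of_apply, Matrix.of_apply, hcoeff _ (degree_partitionExpo_le _ _), hG, coeff_add,
        hF, coeff_additiveWitness, hF', hτ, coeff_additiveWitness_swap]
    rw [hmat]
    exact hdet

/-- **THE SUM DOOR (class form).** For `h ≥ 3` the sum witness lies in `SmallCircuits ℂ (h+h) 5`. -/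
theorem partitionMinor_hit_of_additiveSum_mem {ι : Type*} [Fintype ι] [DecidableEq ι] (h : ℕ)
    (hh : 3 ≤ h) (u w : ι → Finset (Fin h)) (ω₀ : Fin h → ℂ) (ω : Fin h → Fin h → ℂ)
    (ω₀' : Fin h → ℂ) (ω' : Fin h → Fin h → ℂ)
    (hdet : (Matrix.of fun i j : ι => ∏ c ∈ w j, (ω₀ c + ∑ a ∈ u i, ω a c) +
      ∏ a ∈ u i, (ω₀' a + ∑ c ∈ w j, ω' c a)).det ≠ 0) :
    ∃ f ∈ SmallCircuits ℂ (h + h) 5,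
      (Matrix.of fun i j : ι => MvPolynomial.coeff
        (∑ a ∈ u i, Finsupp.single (Fin.castAdd h a) 1 +
          ∑ c ∈ w j, Finsupp.single (Fin.natAdd h c) 1) f).det ≠ 0 := by
  obtain ⟨f, hdeg, hsize, hf⟩ := partitionMinor_hit_of_additiveSum h u w ω₀ ω ω₀' ω' hdet
  refine ⟨f, ⟨hdeg, hsize.trans ?_⟩, hf⟩
  have key : (h + h + 2) ^ 2 * (6 * h * h + 12 * h + 3) + (h + h + 1) ≤ (h + h) ^ 5 := by
    have e1 : 3 * (h + h + 2) ≤ 8 * h := by omega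
    have e2 : 6 * h * h + 12 * h + 3 ≤ 11 * h * h := by nlinarith
    have e3 : 9 * (h + h + 1) ≤ 8 * (h * h * h * h) := by nlinarith
    nlinarith [e1, e2, e3, Nat.zero_le h]
  exact key

/-! ## 3. The link to item 19717 -/

/-- **The SUM door (candidate door of record v6).** If for every `h ≥ 3` and every injective layout
`(u, w)` SOME pair of additive tables makes the sum of the additive matrix and its mirror nonsingular,
item 19717 `PartitionMinorsHitByVP` holds (`b = 5`, `h₀ = 3`). -/
theorem partitionMinorsHitByVP_of_additiveSum
    (hyp : ∀ h : ℕ, 3 ≤ h → ∀ (r : ℕ) (u w : Fin r → Finset (Fin h)),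
      Function.Injective u → Function.Injective w →
      ∃ (ω₀ : Fin h → ℂ) (ω : Fin h → Fin h → ℂ) (ω₀' : Fin h → ℂ) (ω' : Fin h → Fin h → ℂ),
        (Matrix.of fun i j : Fin r => ∏ c ∈ w j, (ω₀ c + ∑ a ∈ u i, ω a c) +
          ∏ a ∈ u i, (ω₀' a + ∑ c ∈ w j, ω' c a)).det ≠ 0) :
    Summit.ValiantsHypothesis.ValiantsHypothesis.Theses.BarrierLever.PartitionMinorsHitByVP := by
  refine ⟨5, 3, fun h hh r u w hu hw => ?_⟩
  obtain ⟨ω₀, ω, ω₀', ω', hdet⟩ := hyp h hh r u w hu hw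
  obtain ⟨f, hf, hd⟩ := partitionMinor_hit_of_additiveSum_mem h hh u w ω₀ ω ω₀' ω' hdet
  exact ⟨f, hf, hd⟩

end

end Summit.ValiantsHypothesis.ValiantsHypothesis.Theorems.BarrierLever.AdditiveDoor
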